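import Summits.MatrixMultiplication.OmegaCensus.SmallFormats.InvertiblePointFootprintExclusion
import HarnessLib

/-!
# ω-census family (a): the footprint reduction with KERNEL-VECTOR support (the interface an `L₀`-free pencil catalog meets)

Cell `pub-omega` (unit `pub-omega-tensor-g32`), topic `Summits/MatrixMultiplication/OmegaCensus` (sub-folder `SmallFormats`).
Framing (verbatim): lottery ticket; floor = certified bounds/negative ranges. HONEST FRAMING: a CORRECTION of interface, same seat.
`CatalogComplete` (`InvertiblePointFootprintExclusion`, p626844) asks a catalog to cover every subspace `WW` with no zero COORDINATE
column. A Weierstraß–Kronecker list WITHOUT `L₀` blocks (such as the census' 1 068 types of `9 × 7` pencils) does NOT satisfy that: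
'no `L₀` block' means 'no common nonzero right-kernel VECTOR `x` (`W x = 0` for all `W ∈ WW`)', a `GL_n`-invariant and strictly
stronger condition (e.g. `WW` with equal first two columns has full coordinate support and an `L₀` block). This file states the
completeness interface in the kernel-vector form (`CatalogCompleteK`, implied by `CatalogComplete`), proves that the footprint space at a
saturated invertible point HAS no common right-kernel vector (`exists_w_mulVec_ne_zero_of_saturated`, strengthening the coordinate
statement `exists_w_col_ne_zero_of_saturated`), and re-proves the reduction with it (`xMarginal_ne_of_catalogK`). The `(7,23)` assembly
must use this form. Nothing on `ω`; no marginal is excluded here.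
-/

namespace Summit.MatrixMultiplication.OmegaCensus.SmallFormats

open Module Matrix Literature.Computability.AlgebraicComplexity RankOnePlaneCapGeneral

variable {k : Type*} [Field k] {n : ℕ} {ι : Type*} [Fintype ι]

/-- **Common right-kernel vectors are inherited by admissible spaces** (generalises `fpSpace_col_eq_zero` from coordinate columns to an
arbitrary vector `x`): if `W x = 0` for all `W ∈ WW`, then `W x = 0` for all `W` in the admissible space of `ker f`. -/
theorem fpSpace_mulVec_eq_zero (f : Module.Dual k (Matrix (Fin 2) (Fin 2) k)) {WW : Submodule k (Matrix (Fin 2) (Fin n) k)}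
    {x : Fin n → k} (hWW : ∀ W ∈ WW, W *ᵥ x = 0) {W : Matrix (Fin 2) (Fin n) k}
    (hW : W ∈ fpSpace (LinearMap.ker f) WW) : W *ᵥ x = 0 := by
  by_contra hne
  obtain ⟨X, hfX, hXw⟩ := exists_ker_mulVec_ne_zero f hne
  apply hXw
  rw [Matrix.mulVec_mulVec]
  exact hWW (X * W) (hW X (LinearMap.mem_ker.mpr hfX))

/-- The linear map `W ↦ W x` on `k^{2×n}`. -/
def mulVecMap (x : Fin n → k) : Matrix (Fin 2) (Fin n) k →ₗ[k] (Fin 2 → k) where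
  toFun W := W *ᵥ x
  map_add' W W' := Matrix.add_mulVec W W' x
  map_smul' a W := Matrix.smul_mulVec a W x

/-- `mulVecMap x W = W x`. -/
@[simp] theorem mulVecMap_apply (x : Fin n → k) (W : Matrix (Fin 2) (Fin n) k) : mulVecMap x W = W *ᵥ x := rfl

/-- For `x ≠ 0` the matrices killing `x` form a proper subspace of `k^{2×n}`. -/
theorem ker_mulVecMap_ne_top {x : Fin n → k} (hx : x ≠ 0) : LinearMap.ker (mulVecMap (k := k) x) ≠ ⊤ := by
  obtain ⟨j, hj⟩ := Function.ne_iff.mp hx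
  intro h
  have hmem : vecMulVec (Pi.single 0 1) (Pi.single j (x j)⁻¹) ∈ LinearMap.ker (mulVecMap (k := k) x) := by
    rw [h]; exact Submodule.mem_top
  rw [LinearMap.mem_ker, mulVecMap_apply, vecMulVec_mulVec, single_dotProduct, inv_mul_cancel₀ hj, MulOpposite.op_one,
    one_smul] at hmem
  have := congr_fun hmem 0
  rw [Pi.single_eq_same, Pi.zero_apply] at this
  exact one_ne_zero this

/-- **No common right-kernel vector at a saturated point.** At a saturated invertible point of a computation of `⟨2,2,n⟩` (`|O| = 2n`),
for every `x ≠ 0` some term vanishing at `X₀` has an output with `W_i x ≠ 0`: otherwise every admissible space kills `x` and Rado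
necessity fails for `T = O`. So the footprint space `span{W_i : i ∉ O}` has no `L₀` block in the Weierstraß–Kronecker sense. -/
theorem exists_w_mulVec_ne_zero_of_saturated (β : BilinComp (mulBilin k 2 2 n) ι) (X₀ : Matrix (Fin 2) (Fin 2) k)
    (hX₀ : IsUnit X₀.det) (O : Finset ι) (hO : ∀ i, i ∉ O → β.f i X₀ = 0) (hO' : ∀ i ∈ O, β.f i X₀ ≠ 0)
    (hcard : O.card = 2 * n) {x : Fin n → k} (hx : x ≠ 0) : ∃ i, i ∉ O ∧ β.w i *ᵥ x ≠ 0 := by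
  classical
  by_contra hall
  push Not at hall
  set WW : Submodule k (Matrix (Fin 2) (Fin n) k) := Submodule.span k (β.w '' {i | i ∉ O}) with hWWdef
  have hWW : ∀ W ∈ WW, W *ᵥ x = 0 := by
    intro W hW
    induction hW using Submodule.span_induction with
    | mem W' hW' =>
        obtain ⟨i, hi, rfl⟩ := hW'
        exact hall i hi
    | zero => exact Matrix.zero_mulVec x
    | add W₁ W₂ _ _ h₁ h₂ => rw [Matrix.add_mulVec, h₁, h₂, add_zero]
    | smul a W' _ h => rw [Matrix.smul_mulVec, h, smul_zero]
  have hle : (⨆ j ∈ O, fpSpace (LinearMap.ker (β.f j)) WW : Submodule k (Matrix (Fin 2) (Fin n) k)) ≤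
      LinearMap.ker (mulVecMap x) := by
    refine iSup₂_le fun j _ => ?_
    intro W hW
    rw [LinearMap.mem_ker, mulVecMap_apply]
    exact fpSpace_mulVec_eq_zero (β.f j) hWW hW
  have h1 := card_le_finrank_biSup_fpSpace β X₀ hX₀ O hO hO' hcard WW le_rfl O (subset_refl O)
  have h2 := Submodule.finrank_mono hle
  have h3 := Submodule.finrank_lt (ker_mulVecMap_ne_top (k := k) hx)
  rw [finrank_matrix_fin] at h3
  omega

/-- **(C′) Catalog completeness, kernel-vector form.** A list `cat` of `d`-tuples of `2 × n` matrices is complete (in this sense) if every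
subspace `WW ⊆ k^{2×n}` of dimension `≤ d` whose members have NO common nonzero right-kernel vector is carried, by some invertible right
multiplication `W ↦ W Q`, INTO the span of a catalog tuple. This is what the Weierstraß–Kronecker classification provides for the list of
`d × n` pencil types without `L₀`/`L₀ᵀ` blocks (with the members of dimension `< d` enlarged); it is an INPUT here. -/
def CatalogCompleteK (n d : ℕ) (cat : List (Fin d → Matrix (Fin 2) (Fin n) k)) : Prop :=
  ∀ WW : Submodule k (Matrix (Fin 2) (Fin n) k), finrank k WW ≤ d →
    (∀ x : Fin n → k, x ≠ 0 → ∃ W ∈ WW, W *ᵥ x ≠ 0) →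
    ∃ b ∈ cat, ∃ Q Q' : Matrix (Fin n) (Fin n) k, Q' * Q = 1 ∧
      WW.map (mulRightLin k Q) ≤ Submodule.span k (Set.range b)

/-- The coordinate form implies the kernel-vector form (take `x = e_c`). -/
theorem catalogCompleteK_of_catalogComplete {d : ℕ} {cat : List (Fin d → Matrix (Fin 2) (Fin n) k)}
    (h : CatalogComplete n d cat) : CatalogCompleteK n d cat := by
  intro WW hdim hsupp
  refine h WW hdim fun c => ?_
  obtain ⟨W, hW, hWx⟩ := hsupp (Pi.single c 1) (by
    intro h0; have := congr_fun h0 c; rw [Pi.single_eq_same, Pi.zero_apply] at this; exact one_ne_zero this)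
  obtain ⟨r, hr⟩ := Function.ne_iff.mp hWx
  refine ⟨W, hW, r, ?_⟩
  rwa [Matrix.mulVec_single, MulOpposite.op_one, one_smul, Pi.zero_apply] at hr

/-- **Footprint exclusion from a catalog, kernel-vector form.** As `xMarginal_ne_of_catalog`, with completeness required only for subspaces
without a common right-kernel vector — the form an `L₀`-free Weierstraß–Kronecker list satisfies. -/
theorem xMarginal_ne_of_catalogK [DecidableEq k] {r d : ℕ} (m : Fin r → Matrix (Fin 2) (Fin 2) k)
    (X₀ : Matrix (Fin 2) (Fin 2) k) (hX₀ : IsUnit X₀.det)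
    (hsat : (Finset.univ.filter fun i => formOf (m i) X₀ = 0).card + 2 * n = r) (hd : d + 2 * n = r)
    (cat : List (Fin d → Matrix (Fin 2) (Fin n) k)) (hcat : CatalogCompleteK n d cat)
    (hkill : ∀ b ∈ cat, RadoFails m X₀ b) (β : BilinComp (mulBilin k 2 2 n) (Fin r)) : xMarginal β ≠ m := by
  intro hm
  have hf : ∀ i, β.f i = formOf (m i) := fun i => by rw [f_eq_formOf_xMarginal, hm]
  -- the off-terms at X₀
  obtain ⟨O, hOdef⟩ : ∃ O : Finset (Fin r), O = Finset.univ.filter (fun i => ¬ formOf (m i) X₀ = 0) := ⟨_, rfl⟩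
  have hO : ∀ i, i ∉ O → β.f i X₀ = 0 := fun i hi => by
    by_contra h
    rw [hf] at h
    exact hi (hOdef ▸ Finset.mem_filter.mpr ⟨Finset.mem_univ i, h⟩)
  have hO' : ∀ i ∈ O, β.f i X₀ ≠ 0 := fun i hi => by
    rw [hf]
    rw [hOdef] at hi
    exact (Finset.mem_filter.mp hi).2
  have hcard : O.card = 2 * n := by
    have h := Finset.card_filter_add_card_filter_not (s := (Finset.univ : Finset (Fin r)))
      (fun i : Fin r => formOf (m i) X₀ = 0)
    rw [← hOdef, Finset.card_univ, Fintype.card_fin] at h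
    omega
  -- the footprint space: dimension ≤ d and no common right-kernel vector
  have hdim : finrank k (Submodule.span k (β.w '' {i | i ∉ O})) ≤ d := by
    have h := finrank_span_w_compl_le β O
    rw [Fintype.card_fin, hcard] at h
    omega
  have hsupp : ∀ x : Fin n → k, x ≠ 0 → ∃ W ∈ Submodule.span k (β.w '' {i | i ∉ O}), W *ᵥ x ≠ 0 := by
    intro x hx
    obtain ⟨i, hi, hix⟩ := exists_w_mulVec_ne_zero_of_saturated β X₀ hX₀ O hO hO' hcard hx
    exact ⟨β.w i, Submodule.subset_span ⟨i, hi, rfl⟩, hix⟩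
  obtain ⟨b, hb, Q, Q', hQ, hle⟩ := hcat _ hdim hsupp
  -- transport the computation along `Y ↦ Y Q`
  set β' := β.sandwich 1 1 Q Q' (Matrix.one_mul 1) hQ with hβ'
  have hf' : ∀ i, β'.f i = β.f i := fun i => by
    ext X; rw [hβ', BilinComp.sandwich_f, Matrix.one_mul]
  have hw' : ∀ i, β'.w i = β.w i * Q := fun i => by rw [hβ', BilinComp.sandwich_w, Matrix.one_mul]
  have hO₁ : ∀ i, i ∉ O → β'.f i X₀ = 0 := fun i hi => by rw [hf']; exact hO i hi
  have hO₁' : ∀ i ∈ O, β'.f i X₀ ≠ 0 := fun i hi => by rw [hf']; exact hO' i hi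
  have hWW' : Submodule.span k (β'.w '' {i | i ∉ O}) ≤ Submodule.span k (Set.range b) := by
    refine Submodule.span_le.mpr ?_
    rintro _ ⟨i, hi, rfl⟩
    rw [hw']
    exact hle (Submodule.mem_map_of_mem (f := mulRightLin k Q) (Submodule.subset_span ⟨i, hi, rfl⟩))
  -- Rado necessity for β' against Rado failure for b
  obtain ⟨T, hT, hlt⟩ := hkill b hb
  have hTO : T ⊆ O := fun j hj => hOdef ▸ Finset.mem_filter.mpr ⟨Finset.mem_univ j, hT j hj⟩
  have hle' := card_le_finrank_biSup_fpSpace β' X₀ hX₀ O hO₁ hO₁' hcard (Submodule.span k (Set.range b)) hWW' T hTO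
  have hsup : (⨆ j ∈ T, fpSpace (LinearMap.ker (β'.f j)) (Submodule.span k (Set.range b)) :
      Submodule k (Matrix (Fin 2) (Fin n) k)) =
      ⨆ j ∈ T, fpSpace (LinearMap.ker (formOf (m j))) (Submodule.span k (Set.range b)) := by
    refine iSup_congr fun j => iSup_congr fun _ => ?_
    rw [hf', hf]
  rw [hsup] at hle'
  omega

end Summit.MatrixMultiplication.OmegaCensus.SmallFormats
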